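/-
COR-CM (cell pub-hodgecm2, stage 2 of the Hodge ladder) — count-neutral KERNEL SCHEMA «INT-2 for a GENERATING SET of faces»
(seat prover-pub-hodgecm2-b23-g30-0, binder prover b23, gen 30; claim INT2-GEN, HOME/lit/LIT-STATUS.md 2026-08-21; sequel of
`CorCM/FacePeriodsFieldLocal.lean`, p272335).  Theorems only; no definition, no named fact, nothing asserted; NOT an E term, NOT a
display of record, no BINDER-OWNERS row; `Interfaces.lean` (C1), `Assembly/ModelChain*.lean` and every `StubTree/*` file untouched — the
[QW8] step Props and their model proofs (seats p1/p2 et al.), Pohlmann's span theorem, `lefChar_eq_sum_faces` and the carriers of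
seats b07/b24 are imported BY NAME.
HONEST FRAMING (COORDINATOR RULING — HODGE FRAMING CORRECTION, 2026-08-21T11:55:35Z): `HC_CM` is NOT proved, here or anywhere in the
tree.  This file proves NO face period and NO generation statement for any particular field; it records that the face periods of a
GENERATING SET of faces of ONE Galois CM field `F` already buy the `F`-generated CM slice of the Hodge conjecture.
-/
import Summits.HodgeConjecture.CorCM.FacePeriodsFieldLocal
import Summits.HodgeConjecture.CorCM.StubTree.Qw8MilneZero
import Summits.HodgeConjecture.CorCM.StubTree.Qw8Geometric
import Summits.HodgeConjecture.CorCM.StubTree.Qw8FaceBridge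
import Summits.HodgeConjecture.CorCM.Proofs.Pohlmann.WeightHodge
import Summits.HodgeConjecture.CorCM.CM.LefschetzChar2
import HarnessLib

/-!
# Face periods of a GENERATING SET of faces of ONE Galois CM field `F` ⟹ the `F`-generated CM slice of the Hodge conjecture

The face reduction of this cell (`Universe.FaceReduction`, kernel `StubTree.faceReduction_holds`; per field in
`CorCM/FacePeriodsFieldLocal.lean`) asks for the algebraicity of the Weil line `W_F(P(f))` of EVERY rank-four face `f` of `F`.
Its engine, [QW8] Thm 2.5 (`Universe.Qw8Sufficiency`, kernel `Universe.qw8Sufficiency_of_steps`, `StubTree/Qw8.lean`), uses the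
face hypothesis only at the faces `f_i` that occur in an INTEGER COMBINATION `a(e_S) = Σ_i c_i · a(w_{f_i, σ₀})` expressing the
Lefschetz character of a Hodge weight `S` through the `σ₀`-Weil characters of faces (`StubTree/Qw8.lean` :318–320); and
`lefChar_eq_sum_faces` (rfwf `l:allg`, `CM/LefschetzChar2.lean`) provides such a combination over SOME faces.  Hence:

  if the Weil characters `lefChar g.corner (· ↦ {σ})` (`g ∈ 𝒮`, `σ` arbitrary) of a SET `𝒮` of faces of `F` GENERATE (as an
  additive subgroup of `Asym F`) the `σ₀`-Weil characters of ALL faces of `F` for one `σ₀`, then the algebraicity of `W_F(P(f))`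
  for `f ∈ 𝒮` alone implies `U.HC (∏_j A_{(F,Θ_j)})` for every finite family `Θ` of CM types of `F`

(§1 `Universe.hc_cmProd_of_faceSet`; the generation hypothesis is stated INLINE as membership in an `AddSubgroup.closure`, no new
definition).  With the per-face atom of `CorCM/FacePeriodsFieldLocal.lean` (`Universe.weilFaceAlgebraic_of_exists_periodNV`: one
period witness ⟹ `W_F(P(f))` algebraic) this gives the degree-local schema in GENERATING-SET form: period witnesses for the faces of
`𝒮` only ⟹ the Hodge conjecture for every complex abelian variety dominated by a product of CM abelian varieties with CM types of CM
subfields of `F` (§3–§4, on the model universe and CLOSED on the universe of record).  `𝒮 = Set.univ` recovers `FaceReduction`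
(`Universe.faceReduction_of_faceSet_univ`), so nothing is lost.

USE (degree-by-degree lane).  Period witnesses are needed, by this file, only for a set of faces whose characters generate; e.g. at
degree `8` seat b30's census (HOME/lit/LIT-STATUS.md OCTIC-FACE-CENSUS (d)) reports `1·2·2·3·2·2` generating square-orbits against
`3·4·4·6·5·3` square-orbits for the six Galois types (the bridge from that census model to `lefChar`/`Asym F` is not in this file).

Contents: §1 abstract universe ([QW8] Thm 2.5 for a face set; the face reduction for a generating set; witness form; `𝒮 = univ`
sanity); §2 the nine textbook facts spelled out; §3 the model universe modulo Riemann's theorem `hR`; §4 CLOSED forms on the universe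
of record (headline `hodgeConjectureFor_of_avDominatedBy_isProductOf_of_exists_facePeriod_on`, socket form over `FaceThetaDatum`).

References: [QW8] Thm 2.5 (kernel: `StubTree/Qw8*.lean`); Pohlmann 1968 Thm. 1; Milne, Duke 96 (1999) Thm. 3.2 / Cor. 4.5;
André 1992; Shimura 1998 §6.1–6.2; Mumford §19; Deligne–Milne LNM 900 Thm. 6.20.
-/

noncomputable section

open CategoryTheory NumberField
open Literature.AlgebraicGeometry Literature.AlgebraicGeometry.Motives Literature.AlgebraicGeometry.HodgeTheory
open Literature.AlgebraicGeometry.ComplexMultiplication Literature.AlgebraicGeometry.Milne1999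
open Literature.NumberTheory.Automorphic
open Literature.NumberTheory.Automorphic.PicardCM

namespace Summit.HodgeConjecture.CorCM

/-! ## §1 Abstract universe: [QW8] Thm 2.5 and the face reduction for a SET of faces -/

namespace Universe

variable {U : Universe}

/-- **[QW8] Thm 2.5 for a SET of faces.**  On a universe with the five [QW8] step properties (conjugation `Qw8Conj`, exterior
products `Qw8ExtProd`, duality/push–pull `Qw8DualPushPull`, Milne 1999 `Qw8Milne`, the ā-bridge `Qw8FaceBridge`): let `F` be a Galois
CM field with `6 ≤ [F:ℚ]` and `𝒮` a set of faces of `F` whose Weil lines are algebraic.  A weight vector `x` of weight `S` on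
`∏_j A_{(F,Θ_j)}` whose Lefschetz character `lefChar Θ S` lies in the additive subgroup of `Asym F` generated by the Weil
characters `lefChar g.corner (· ↦ {σ})`, `g ∈ 𝒮`, `σ : F →+* ℂ` arbitrary, is a complexified algebraic class.  (The argument of
`Universe.qw8Sufficiency_of_steps` verbatim, with the subgroup of characters of non-zero algebraic weight vectors shown to contain
the generators from `𝒮` only.) [cite: Milne1999LefschetzClasses, Thm. 3.2 and Cor. 4.5] [cite: Pohlmann1968, Thm. 1] -/
theorem algC_of_isWeightVector_of_faceSet (hC : U.Qw8Conj) (hE : U.Qw8ExtProd) (hD : U.Qw8DualPushPull)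
    (hM : U.Qw8Milne) (hB : U.Qw8FaceBridge) {F : CMField} (hGal : IsGalois ℚ F) (h6 : 6 ≤ Module.finrank ℚ F)
    {𝒮 : Set (Face F)} (hWeil : ∀ f ∈ 𝒮, U.WeilFaceAlgebraic F f) {n : ℕ} {Θ : Fin (n + 1) → CMType F} {p : ℕ}
    {S : Fin (n + 1) → Finset ((F : Type) →+* ℂ)} {x : U.CohC (U.cmProd F Θ) (2 * p)}
    (hx : U.IsWeightVector F Θ S (2 * p) x) (σ₀ : (F : Type) →+* ℂ)
    (hchar : lefChar Θ S ∈ AddSubgroup.closure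
      {a : Asym F | ∃ g ∈ 𝒮, ∃ σ : (F : Type) →+* ℂ,
        a = lefChar g.corner (fun _ => ({σ} : Finset ((F : Type) →+* ℂ)))}) :
    x ∈ U.algC (U.cmProd F Θ) p := by
  by_cases hx0 : x = 0
  · rw [hx0]; exact Submodule.zero_mem _
  let e : U.WVec F := ⟨n, Θ, p, S, x, hx0, hx⟩
  change e.IsAlg
  have he : e.achar = lefChar Θ S := rfl
  by_cases ha : e.achar = 0
  · exact hM F hGal h6 e ha
  -- an empty face set generates only `0`, but `a(e) ≠ 0`
  rcases Set.eq_empty_or_nonempty 𝒮 with h𝒮 | ⟨g₀, hg₀⟩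
  · exfalso
    apply ha
    have hset : {a : Asym F | ∃ g ∈ 𝒮, ∃ σ : (F : Type) →+* ℂ,
        a = lefChar g.corner (fun _ => ({σ} : Finset ((F : Type) →+* ℂ)))} = ∅ := by
      ext a
      simp [h𝒮]
    rw [hset, AddSubgroup.closure_empty, AddSubgroup.mem_bot] at hchar
    rw [he, hchar]
  -- the set of characters carried by nonzero algebraic weight vectors
  let A : Set (Asym F) := {a | ∃ z : U.WVec F, z.IsAlg ∧ z.achar = a}
  have hAneg : ∀ a ∈ A, -a ∈ A := by
    rintro a ⟨z, hz, rfl⟩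
    obtain ⟨z', hz', h'⟩ := hC F z hz
    exact ⟨z', hz', h'⟩
  have hAadd : ∀ a ∈ A, ∀ b ∈ A, a + b ∈ A := by
    rintro a ⟨z, hz, rfl⟩ b ⟨w, hw, rfl⟩
    obtain ⟨y, hy, h'⟩ := hE F hGal h6 z w hz hw
    exact ⟨y, hy, h'⟩
  -- the ā-bridge, at the faces of `𝒮` ONLY
  have hface : ∀ g ∈ 𝒮, ∀ σ : (F : Type) →+* ℂ, lefChar g.corner (fun _ => ({σ} : Finset ((F : Type) →+* ℂ))) ∈ A := by
    intro g hg σ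
    obtain ⟨y, hy0, hyw, hya⟩ := hB F hGal h6 g (hWeil g hg) σ
    exact ⟨⟨3, g.corner, 2, fun _ => {σ}, y, hy0, hyw⟩, hya, rfl⟩
  have h0 : (0 : Asym F) ∈ A := by
    have h := hAadd _ (hface g₀ hg₀ σ₀) _ (hAneg _ (hface g₀ hg₀ σ₀))
    rwa [add_neg_cancel] at h
  let G : AddSubgroup (Asym F) :=
    { carrier := A
      zero_mem' := h0
      add_mem' := fun ha hb => hAadd _ ha _ hb
      neg_mem' := fun ha => hAneg _ ha }
  have hle : AddSubgroup.closure
      {a : Asym F | ∃ g ∈ 𝒮, ∃ σ : (F : Type) →+* ℂ,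
        a = lefChar g.corner (fun _ => ({σ} : Finset ((F : Type) →+* ℂ)))} ≤ G := by
    rw [AddSubgroup.closure_le]
    rintro a ⟨g, hg, σ, rfl⟩
    exact hface g hg σ
  have heA : e.achar ∈ G := by
    rw [he]
    exact hle hchar
  obtain ⟨W, hW, hWa⟩ := heA
  obtain ⟨Z, hZa, hZ⟩ := hD F hGal h6 e W hW
  exact hZ (hM F hGal h6 Z (by rw [hZa, hWa, sub_self]))

/-- **FACE REDUCTION FOR A GENERATING SET OF FACES (abstract).**  With Pohlmann's span theorem (`PohlmannSpan`) in addition: for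
ONE Galois CM field `F` with `6 ≤ [F:ℚ]`, a set `𝒮` of faces of `F` and an embedding `σ₀` such that the `σ₀`-Weil character of EVERY
face of `F` lies in the additive subgroup generated by the Weil characters (at all `σ`) of the faces of `𝒮` (so `𝒮` generates,
through rfwf `l:allg` `lefChar_eq_sum_faces` at `σ₀`, the Lefschetz characters of all Hodge weights), the algebraicity of
`W_F(P(f))` for `f ∈ 𝒮` implies
`U.HC (∏_j A_{(F,Θ_j)})` — in every codimension, for every finite family `Θ` of CM types of `F`.  (The proof of
`StubTree.faceReduction_holds` with `algC_of_isWeightVector_of_faceSet` in place of `Qw8Sufficiency`.)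
[cite: Pohlmann1968, Thm. 1] [cite: Milne1999LefschetzClasses, Thm. 3.2 and Cor. 4.5] [cite: Andre1992HodgeCM, Théorème (pp. 4–5)] -/
theorem hc_cmProd_of_faceSet (hP : U.PohlmannSpan) (hC : U.Qw8Conj) (hE : U.Qw8ExtProd) (hD : U.Qw8DualPushPull)
    (hM : U.Qw8Milne) (hB : U.Qw8FaceBridge) {F : CMField} (hGal : IsGalois ℚ F) (h6 : 6 ≤ Module.finrank ℚ F)
    (𝒮 : Set (Face F)) (σ₀ : (F : Type) →+* ℂ)
    (hgen : ∀ f : Face F, lefChar f.corner (fun _ => ({σ₀} : Finset ((F : Type) →+* ℂ))) ∈ AddSubgroup.closure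
      {a : Asym F | ∃ g ∈ 𝒮, ∃ σ : (F : Type) →+* ℂ,
        a = lefChar g.corner (fun _ => ({σ} : Finset ((F : Type) →+* ℂ)))})
    (hWeil : ∀ f ∈ 𝒮, U.WeilFaceAlgebraic F f) {n : ℕ} (Θ : Fin (n + 1) → CMType F) : U.HC (U.cmProd F Θ) := by
  intro p c hc
  haveI := hGal
  have h1 : (HodgeStructure.ofRat c : U.CohC (U.cmProd F Θ) (2 * p)) ∈
      Submodule.span ℂ {x : U.CohC (U.cmProd F Θ) (2 * p) |
        ∃ S : Fin (n + 1) → Finset ((F : Type) →+* ℂ),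
          IsHodgeWeight Θ p S ∧ U.IsWeightVector F Θ S (2 * p) x} :=
    hP F hGal h6 n Θ p (Submodule.mem_map_of_mem hc)
  have h2 : Submodule.span ℂ {x : U.CohC (U.cmProd F Θ) (2 * p) |
        ∃ S : Fin (n + 1) → Finset ((F : Type) →+* ℂ),
          IsHodgeWeight Θ p S ∧ U.IsWeightVector F Θ S (2 * p) x} ≤ U.algC (U.cmProd F Θ) p := by
    rw [Submodule.span_le]
    rintro x ⟨S, hS, hx⟩
    obtain ⟨m, f, cf, hsum⟩ := lefChar_eq_sum_faces Θ S hS σ₀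
    refine algC_of_isWeightVector_of_faceSet hC hE hD hM hB hGal h6 hWeil hx σ₀ ?_
    rw [hsum]
    exact AddSubgroup.sum_mem _ (fun i _ => AddSubgroup.zsmul_mem _ (hgen (f i)) (cf i))
  exact U.mem_alg_of_ofRat_mem_algC (h2 h1)

/-- **… from period WITNESSES on the faces of `𝒮` only** (the per-face atom `weilFaceAlgebraic_of_exists_periodNV` of
`CorCM/FacePeriodsFieldLocal.lean`: one admissible `ι₁`, one hermitian 3-space `V`, one level, eigenforms at one `σ`, per face of `𝒮`).
[cite: Pohlmann1968, Thm. 1] [cite: Shimura1998, §6.2 Theorem 3 (pp. 41–43)] -/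
theorem hc_cmProd_of_faceSet_of_exists_periodNV (hP : U.PohlmannSpan) (hC : U.Qw8Conj) (hE : U.Qw8ExtProd)
    (hD : U.Qw8DualPushPull) (hM : U.Qw8Milne) (hB : U.Qw8FaceBridge) (hEig : U.Fact_eigenLine) (hA : U.Fact_alphaLine)
    (h22 : U.SurfaceCriterion) (hdim : U.PmsDimTwo) {F : CMField} (hGal : IsGalois ℚ F) (h6 : 6 ≤ Module.finrank ℚ F)
    (𝒮 : Set (Face F)) (σ₀ : (F : Type) →+* ℂ)
    (hgen : ∀ f : Face F, lefChar f.corner (fun _ => ({σ₀} : Finset ((F : Type) →+* ℂ))) ∈ AddSubgroup.closure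
      {a : Asym F | ∃ g ∈ 𝒮, ∃ σ : (F : Type) →+* ℂ,
        a = lefChar g.corner (fun _ => ({σ} : Finset ((F : Type) →+* ℂ)))})
    (hwit : ∀ f ∈ 𝒮, ∃ ι₁ : F →+* ℂ, f.Admissible ι₁ ∧ ∃ (V : HermSpace3 F ι₁) (σ : F →+* ℂ),
      U.PeriodNV ι₁ V F f.psi σ)
    {n : ℕ} (Θ : Fin (n + 1) → CMType F) : U.HC (U.cmProd F Θ) :=
  hc_cmProd_of_faceSet hP hC hE hD hM hB hGal h6 𝒮 σ₀ hgen
    (fun f hf => weilFaceAlgebraic_of_exists_periodNV hEig hA h22 hdim hGal f (hwit f hf)) Θ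

/-- **Sanity: `𝒮 = Set.univ` recovers the face reduction** (`Universe.FaceReduction`) from the same six inputs — the generating-set
form loses nothing. [cite: Pohlmann1968, Thm. 1] -/
theorem faceReduction_of_faceSet_univ (hP : U.PohlmannSpan) (hC : U.Qw8Conj) (hE : U.Qw8ExtProd)
    (hD : U.Qw8DualPushPull) (hM : U.Qw8Milne) (hB : U.Qw8FaceBridge) : U.FaceReduction :=
  fun F hGal h6 hfaces _ Θ =>
    hc_cmProd_of_faceSet hP hC hE hD hM hB hGal h6 Set.univ (Classical.arbitrary ((F : Type) →+* ℂ))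
      (fun f => AddSubgroup.subset_closure ⟨f, Set.mem_univ f, _, rfl⟩) (fun f _ => hfaces f) Θ

end Universe

/-! ## §2 With the textbook facts spelled out (pattern of `Assembly.hc_cm_of_exists_periodNV`) -/

namespace Assembly

open Universe StubTree

variable (U : Universe)

/-- **Face reduction for a generating set of faces, over the model facts**: for a universe with the 28 model facts `ModelAxioms` and
N1–N4, F2, F4–F7 (which give Pohlmann's span theorem and the five [QW8] steps: `pohlmannSpan_of_facts`, `qw8Conj_holds`,
`qw8ExtProd_of_facts`, `qw8DualPushPull_of_facts`, `qw8Milne_of_facts`, `qw8FaceBridge_holds`), ONE Galois CM field `F` with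
`6 ≤ [F:ℚ]`, and a set `𝒮` of faces whose `σ₀`-Weil characters generate those of all faces: algebraicity of `W_F(P(f))` for
`f ∈ 𝒮` implies `U.HC (∏_j A_{(F,Θ_j)})` for every `Θ`. [cite: Pohlmann1968, Thm. 1]
[cite: Milne1999LefschetzClasses, Thm. 3.2 and Cor. 4.5] -/
theorem hc_cmProd_of_faceSet (M : U.ModelAxioms)
    (hN1 : U.Fact_cupExterior) (hN2 : U.Fact_cup_hodge) (hN3 : U.Fact_pull_H0) (hN4 : U.Fact_hodge_F0)
    (h2 : U.Fact_factorActDescends) (h4 : U.Fact_cupAlg) (h5 : U.Fact_cupAssoc) (h6 : U.Fact_weightDual)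
    (h7 : U.Fact_gysin) {F : CMField} (hGal : IsGalois ℚ F) (hdeg : 6 ≤ Module.finrank ℚ F)
    (𝒮 : Set (Face F)) (σ₀ : (F : Type) →+* ℂ)
    (hgen : ∀ f : Face F, lefChar f.corner (fun _ => ({σ₀} : Finset ((F : Type) →+* ℂ))) ∈ AddSubgroup.closure
      {a : Asym F | ∃ g ∈ 𝒮, ∃ σ : (F : Type) →+* ℂ,
        a = lefChar g.corner (fun _ => ({σ} : Finset ((F : Type) →+* ℂ)))})
    (hWeil : ∀ f ∈ 𝒮, U.WeilFaceAlgebraic F f) {n : ℕ} (Θ : Fin (n + 1) → CMType F) : U.HC (U.cmProd F Θ) :=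
  Universe.hc_cmProd_of_faceSet (U.pohlmannSpan_of_facts M hN1 hN2 hN3 hN4) U.qw8Conj_holds
    (U.qw8ExtProd_of_facts M h2 h4 h5 h6 h7) (U.qw8DualPushPull_of_facts M h2 h4 h5 h6 h7)
    (qw8Milne_of_facts M hN1 hN2 hN3 hN4 h2 h4 h5 h6 h7) (qw8FaceBridge_holds M) hGal hdeg 𝒮 σ₀ hgen hWeil Θ

end Assembly

/-! ## §3 The model universe `Model.universeOf hHD hI hU h₃`, modulo Riemann's theorem -/

namespace Model

open Summit.HodgeConjecture.CorCM.Domination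

/-- **Face reduction for a generating set of faces, on the model** (rows fed exactly as in
`Model.universeOf_faceReduction_of_riemann`): modulo Riemann's theorem `hR` (Deligne–Milne 1982 Thm 6.20), for ONE Galois CM field
`F` with `6 ≤ [F:ℚ]` and a generating set `𝒮` of faces, algebraicity of the Weil lines of the faces of `𝒮` gives
`U.HC (∏_j A_{(F,Θ_j)})` on `Model.universeOf hHD hI hU h₃` for every `Θ`.
[cite: Pohlmann1968, Thm. 1] [cite: Milne1999LefschetzClasses, Thm. 3.2 and Cor. 4.5]
[cite: DeligneMilne1982Tannakian, §6 Thm. 6.20 (Riemann), p. 212] -/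
theorem universeOf_hc_cmProd_of_faceSet
    (hHD : exists_isReal_hodgeModel) (hI : hodgePQ_independent_of_hodgeModel) (hU : BallQuotientUniformisedDatum)
    (h₃ : CMAbelianVarietyRealised) (hR : DeligneMilne1982_Thm_6_20_full) {F : CMField} (hGal : IsGalois ℚ F)
    (h6 : 6 ≤ Module.finrank ℚ F) (𝒮 : Set (Face F)) (σ₀ : (F : Type) →+* ℂ)
    (hgen : ∀ f : Face F, lefChar f.corner (fun _ => ({σ₀} : Finset ((F : Type) →+* ℂ))) ∈ AddSubgroup.closure
      {a : Asym F | ∃ g ∈ 𝒮, ∃ σ : (F : Type) →+* ℂ,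
        a = lefChar g.corner (fun _ => ({σ} : Finset ((F : Type) →+* ℂ)))})
    (hWeil : ∀ f ∈ 𝒮, (universeOf hHD hI hU h₃).WeilFaceAlgebraic F f)
    {n : ℕ} (Θ : Fin (n + 1) → CMType F) :
    (universeOf hHD hI hU h₃).HC ((universeOf hHD hI hU h₃).cmProd F Θ) :=
  Assembly.hc_cmProd_of_faceSet (universeOf hHD hI hU h₃)
    (modelAxioms_of_rows hHD hI hU h₃ hR (universeOf_algDuality hHD hI hU h₃))
    (universeOf_fact_cupExterior hHD hI hU h₃) (universeOf_fact_cup_hodge hHD hI hU h₃)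
    (universeOf_fact_pull_H0 hHD hI hU h₃) (universeOf_fact_hodge_F0 hHD hI hU h₃)
    (universeOf_fact_factorActDescends hHD hI hU h₃
      (modelAxioms_of_rows hHD hI hU h₃ hR (universeOf_algDuality hHD hI hU h₃)))
    (universeOf_fact_cupAlg hHD hI hU h₃) (universeOf_fact_cupAssoc hHD hI hU h₃)
    (universeOf_fact_weightDual hHD hI hU h₃
      (modelAxioms_of_rows hHD hI hU h₃ hR (universeOf_algDuality hHD hI hU h₃)))
    (universeOf_fact_gysin hHD hI hU h₃) hGal h6 𝒮 σ₀ hgen hWeil Θ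

/-- **… from period witnesses on the faces of `𝒮` only, on the model** (`Model.universeOf_weilFaceAlgebraic_of_exists_periodNV`).
[cite: Pohlmann1968, Thm. 1] [cite: Shimura1998, §6.2 Theorem 3 (pp. 41–43)] -/
theorem universeOf_hc_cmProd_of_faceSet_of_exists_periodNV
    (hHD : exists_isReal_hodgeModel) (hI : hodgePQ_independent_of_hodgeModel) (hU : BallQuotientUniformisedDatum)
    (h₃ : CMAbelianVarietyRealised) (hR : DeligneMilne1982_Thm_6_20_full) {F : CMField} (hGal : IsGalois ℚ F)
    (h6 : 6 ≤ Module.finrank ℚ F) (𝒮 : Set (Face F)) (σ₀ : (F : Type) →+* ℂ)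
    (hgen : ∀ f : Face F, lefChar f.corner (fun _ => ({σ₀} : Finset ((F : Type) →+* ℂ))) ∈ AddSubgroup.closure
      {a : Asym F | ∃ g ∈ 𝒮, ∃ σ : (F : Type) →+* ℂ,
        a = lefChar g.corner (fun _ => ({σ} : Finset ((F : Type) →+* ℂ)))})
    (hwit : ∀ f ∈ 𝒮, ∃ ι₁ : F →+* ℂ, f.Admissible ι₁ ∧ ∃ (V : HermSpace3 F ι₁) (σ : F →+* ℂ),
      (universeOf hHD hI hU h₃).PeriodNV ι₁ V F f.psi σ)
    {n : ℕ} (Θ : Fin (n + 1) → CMType F) :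
    (universeOf hHD hI hU h₃).HC ((universeOf hHD hI hU h₃).cmProd F Θ) :=
  universeOf_hc_cmProd_of_faceSet hHD hI hU h₃ hR hGal h6 𝒮 σ₀ hgen
    (fun f hf => universeOf_weilFaceAlgebraic_of_exists_periodNV hHD hI hU h₃ hR hGal f (hwit f hf)) Θ

/-- **On the tree's abelian variety `∏_j A_{(F,Θ_j)}`** (`Domination.cmProdAV F h₃ n Θ`; its underlying scheme interprets
`U.cmProd F Θ`, `scheme_cmProd_universeOf`; dimensions by `schemeDim_eq_holds`; `universeOf_hc_iff_hodgeConjectureFor`): the Hodge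
conjecture in every codimension, from the algebraicity of the Weil lines of a generating set of faces of `F`, modulo `hR` and the model
data. [cite: Pohlmann1968, Thm. 1] [cite: Milne2020HodgeClassesAV, Theorem 1] -/
theorem hodgeConjectureFor_cmProdAV_of_faceSet
    (hHD : exists_isReal_hodgeModel) (hI : hodgePQ_independent_of_hodgeModel) (hU : BallQuotientUniformisedDatum)
    (h₃ : CMAbelianVarietyRealised) (hR : DeligneMilne1982_Thm_6_20_full) {F : CMField} (hGal : IsGalois ℚ F)
    (h6 : 6 ≤ Module.finrank ℚ F) (𝒮 : Set (Face F)) (σ₀ : (F : Type) →+* ℂ)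
    (hgen : ∀ f : Face F, lefChar f.corner (fun _ => ({σ₀} : Finset ((F : Type) →+* ℂ))) ∈ AddSubgroup.closure
      {a : Asym F | ∃ g ∈ 𝒮, ∃ σ : (F : Type) →+* ℂ,
        a = lefChar g.corner (fun _ => ({σ} : Finset ((F : Type) →+* ℂ)))})
    (hWeil : ∀ f ∈ 𝒮, (universeOf hHD hI hU h₃).WeilFaceAlgebraic F f)
    {n : ℕ} (Θ : Fin (n + 1) → CMType F) :
    HodgeConjectureFor (cmProdAV F h₃ n Θ).dim (cmProdAV F h₃ n Θ).X := by
  have hX : PicardCM.Var.scheme hU h₃ ((universeOf hHD hI hU h₃).cmProd F Θ) = (cmProdAV F h₃ n Θ).X :=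
    scheme_cmProd_universeOf hHD hI hU h₃ F n Θ
  have hdim : (cmProdAV F h₃ n Θ).dim = (universeOf hHD hI hU h₃).dim ((universeOf hHD hI hU h₃).cmProd F Θ) := by
    rw [AbelianVariety.dim, ← hX]
    exact schemeDim_eq_holds (PicardCM.Var.isSmoothProjective hU h₃ _)
  rw [hdim, ← hX]
  exact (universeOf_hc_iff_hodgeConjectureFor hHD hI hU h₃ _).1
    (universeOf_hc_cmProd_of_faceSet hHD hI hU h₃ hR hGal h6 𝒮 σ₀ hgen hWeil Θ)

/-- **The `F`-generated CM slice from a generating set of faces, on the model**: every complex abelian variety `A` dominated by a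
finite product `P` of abelian varieties each realising on `H¹` a CM type of a CM field `E` with `E →+* F` satisfies the Hodge
conjecture in every codimension, from the algebraicity of the Weil lines of the faces of `𝒮` — modulo `hR` and the model data
(domination calculus of `CorCM/Model/CMSliceOfWeilFaces.lean` §1 by name).
[cite: Shimura1998, §6.2 Theorem 3 and §6.1 Corollary of Theorem 2 (pp. 41–43)] [cite: MumfordAV1970, §19 Thm. 1 and p. 169] -/
theorem hodgeConjectureFor_of_avDominatedBy_isProductOf_of_faceSet
    (hHD : exists_isReal_hodgeModel) (hI : hodgePQ_independent_of_hodgeModel) (hU : BallQuotientUniformisedDatum)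
    (h₃ : CMAbelianVarietyRealised) (hR : DeligneMilne1982_Thm_6_20_full) {F : CMField} (hGal : IsGalois ℚ F)
    (h6 : 6 ≤ Module.finrank ℚ F) (𝒮 : Set (Face F)) (σ₀ : (F : Type) →+* ℂ)
    (hgen : ∀ f : Face F, lefChar f.corner (fun _ => ({σ₀} : Finset ((F : Type) →+* ℂ))) ∈ AddSubgroup.closure
      {a : Asym F | ∃ g ∈ 𝒮, ∃ σ : (F : Type) →+* ℂ,
        a = lefChar g.corner (fun _ => ({σ} : Finset ((F : Type) →+* ℂ)))})
    (hWeil : ∀ f ∈ 𝒮, (universeOf hHD hI hU h₃).WeilFaceAlgebraic F f)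
    {P A : AbelianVariety ℂ} (hP : AbelianVariety.IsProductOf (fun B : AbelianVariety ℂ =>
      ∃ (E : Type) (_ : Field E) (_ : NumberField E) (_ : IsCMField E) (_ : E →+* (F : Type)) (Φ : CMType E)
        (ι : 𝓞 E →+* End B) (θ : E →+* Module.End ℂ (complexBetti B.X 1)),
        IsCMTypeRealisation Φ B ι θ) P)
    (hA : AVDominatedBy A P) : HodgeConjectureFor A.dim A.X := by
  obtain ⟨n, Θ, h⟩ := exists_avDominatedBy_cmProdAV_of_isProductOf_realisations h₃
    (thm3_isogenousPower_of_riemann hR h₃) (thm2_cor_of_riemann hR) hP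
  exact hodgeConjectureFor_of_avDominatedBy
    (hodgeConjectureFor_cmProdAV_of_faceSet hHD hI hU h₃ hR hGal h6 𝒮 σ₀ hgen hWeil Θ) (hA.trans h)

end Model

/-! ## §4 CLOSED forms on the universe of record (model data = tree theorems) -/

open Summit.HodgeConjecture.CorCM.Domination

/-- **INT-2 FOR A GENERATING SET OF FACES, CLOSED — Weil-line form.**  For ONE Galois CM field `K` with `6 ≤ [K:ℚ]`, an embedding
`σ₀` and a set `𝒮` of faces of `K` whose `σ₀`-Weil characters generate those of all faces: if the Weil lines `W_K(P(f))`, `f ∈ 𝒮`,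
are algebraic on the universe of record (at the tree theorems `exists_isReal_hodgeModel_holds`, `hodgePQ_independent_of_hodgeModel_holds`,
`BallQuotient.ballQuotientUniformised_holds`, `cmAbelianVarietyRealised_holds`; Riemann's theorem by `deligneMilne1982_Thm_6_20_full_holds`),
then every complex abelian variety dominated by a finite product of realisations of CM types of CM fields embeddable in `K` satisfies
the Hodge conjecture in every codimension. [cite: Shimura1998, §6.2 Theorem 3 and §6.1 Corollary of Theorem 2 (pp. 41–43)]
[cite: Pohlmann1968, Thm. 1] [cite: Milne1999LefschetzClasses, Thm. 3.2 and Cor. 4.5] [cite: MumfordAV1970, §19 Thm. 1 and p. 169] -/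
theorem hodgeConjectureFor_of_avDominatedBy_isProductOf_of_weilFaceAlgebraic_on (K : CMField) [hGal : IsGalois ℚ K]
    (h6 : 6 ≤ Module.finrank ℚ K) (𝒮 : Set (Face K)) (σ₀ : (K : Type) →+* ℂ)
    (hgen : ∀ f : Face K, lefChar f.corner (fun _ => ({σ₀} : Finset ((K : Type) →+* ℂ))) ∈ AddSubgroup.closure
      {a : Asym K | ∃ g ∈ 𝒮, ∃ σ : (K : Type) →+* ℂ,
        a = lefChar g.corner (fun _ => ({σ} : Finset ((K : Type) →+* ℂ)))})
    (hWeil : ∀ f ∈ 𝒮, (Model.picardCMUniverse exists_isReal_hodgeModel_holds hodgePQ_independent_of_hodgeModel_holds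
      BallQuotient.ballQuotientUniformised_holds cmAbelianVarietyRealised_holds).WeilFaceAlgebraic K f)
    {P A : AbelianVariety ℂ} (hP : AbelianVariety.IsProductOf (fun B : AbelianVariety ℂ =>
      ∃ (E : Type) (_ : Field E) (_ : NumberField E) (_ : IsCMField E) (_ : E →+* (K : Type)) (Φ : CMType E)
        (ι : 𝓞 E →+* End B) (θ : E →+* Module.End ℂ (complexBetti B.X 1)),
        IsCMTypeRealisation Φ B ι θ) P)
    (hA : AVDominatedBy A P) : HodgeConjectureFor A.dim A.X :=
  Model.hodgeConjectureFor_of_avDominatedBy_isProductOf_of_faceSet _ _ _ _ deligneMilne1982_Thm_6_20_full_holds hGal h6 𝒮 σ₀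
    hgen hWeil hP hA

/-- **INT-2 FOR A GENERATING SET OF FACES, CLOSED — period-witness form (headline).**  For ONE Galois CM field `K` with
`6 ≤ [K:ℚ]`, an embedding `σ₀` and a set `𝒮` of faces of `K` whose `σ₀`-Weil characters generate those of all faces of `K`: ONE
period witness per face OF `𝒮` on the universe of record (some admissible `ι₁`, some hermitian 3-space `V`, some level, eigenforms at
some `σ`) implies the Hodge conjecture, in every codimension, for every complex abelian variety `A` dominated by a finite product of
abelian varieties each realising a CM type of a CM field `E` with `E →+* K`.  NO other hypothesis.  (FRAMING: a statement about the
abelian varieties generated by ONE field `K`, conditional on the face periods of `𝒮` and on the generation binder `hgen`; `HC_CM` is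
not proved.) [cite: Shimura1998, §6.2 Theorem 3 and §6.1 Corollary of Theorem 2 (pp. 41–43)] [cite: Pohlmann1968, Thm. 1]
[cite: Milne1999LefschetzClasses, Thm. 3.2 and Cor. 4.5] [cite: MumfordAV1970, §19 Thm. 1 and p. 169] -/
theorem hodgeConjectureFor_of_avDominatedBy_isProductOf_of_exists_facePeriod_on (K : CMField) [hGal : IsGalois ℚ K]
    (h6 : 6 ≤ Module.finrank ℚ K) (𝒮 : Set (Face K)) (σ₀ : (K : Type) →+* ℂ)
    (hgen : ∀ f : Face K, lefChar f.corner (fun _ => ({σ₀} : Finset ((K : Type) →+* ℂ))) ∈ AddSubgroup.closure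
      {a : Asym K | ∃ g ∈ 𝒮, ∃ σ : (K : Type) →+* ℂ,
        a = lefChar g.corner (fun _ => ({σ} : Finset ((K : Type) →+* ℂ)))})
    (h : ∀ f ∈ 𝒮, ∃ ι₁ : K →+* ℂ, f.Admissible ι₁ ∧ ∃ (V : HermSpace3 K ι₁) (σ : K →+* ℂ),
      (Model.picardCMUniverse exists_isReal_hodgeModel_holds hodgePQ_independent_of_hodgeModel_holds
        BallQuotient.ballQuotientUniformised_holds cmAbelianVarietyRealised_holds).PeriodNV ι₁ V K f.psi σ)
    {P A : AbelianVariety ℂ} (hP : AbelianVariety.IsProductOf (fun B : AbelianVariety ℂ =>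
      ∃ (E : Type) (_ : Field E) (_ : NumberField E) (_ : IsCMField E) (_ : E →+* (K : Type)) (Φ : CMType E)
        (ι : 𝓞 E →+* End B) (θ : E →+* Module.End ℂ (complexBetti B.X 1)),
        IsCMTypeRealisation Φ B ι θ) P)
    (hA : AVDominatedBy A P) : HodgeConjectureFor A.dim A.X :=
  hodgeConjectureFor_of_avDominatedBy_isProductOf_of_weilFaceAlgebraic_on K h6 𝒮 σ₀ hgen
    (fun f hf => weilFaceAlgebraic_of_exists_facePeriod hGal f (h f hf)) hP hA

/-- **Socket form** of the headline: face-scoped theta data (`FaceThetaDatum`, `CorCM/B01/ThetaRealisationSocket.lean`) for the faces of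
`𝒮` only. [cite: Shimura1998, §6.2 Theorem 3 and §6.1 Corollary of Theorem 2 (pp. 41–43)] [cite: Pohlmann1968, Thm. 1] -/
theorem hodgeConjectureFor_of_avDominatedBy_isProductOf_of_faceThetaData_on (K : CMField) [hGal : IsGalois ℚ K]
    (h6 : 6 ≤ Module.finrank ℚ K) (𝒮 : Set (Face K)) (σ₀ : (K : Type) →+* ℂ)
    (hgen : ∀ f : Face K, lefChar f.corner (fun _ => ({σ₀} : Finset ((K : Type) →+* ℂ))) ∈ AddSubgroup.closure
      {a : Asym K | ∃ g ∈ 𝒮, ∃ σ : (K : Type) →+* ℂ,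
        a = lefChar g.corner (fun _ => ({σ} : Finset ((K : Type) →+* ℂ)))})
    (h : ∀ f ∈ 𝒮, ∃ ι₁ : K →+* ℂ, f.Admissible ι₁ ∧ ∃ V : HermSpace3 K ι₁,
      Nonempty ((Model.picardCMUniverse exists_isReal_hodgeModel_holds hodgePQ_independent_of_hodgeModel_holds
        BallQuotient.ballQuotientUniformised_holds cmAbelianVarietyRealised_holds).FaceThetaDatum ι₁ V K f.psi ι₁))
    {P A : AbelianVariety ℂ} (hP : AbelianVariety.IsProductOf (fun B : AbelianVariety ℂ =>
      ∃ (E : Type) (_ : Field E) (_ : NumberField E) (_ : IsCMField E) (_ : E →+* (K : Type)) (Φ : CMType E)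
        (ι : 𝓞 E →+* End B) (θ : E →+* Module.End ℂ (complexBetti B.X 1)),
        IsCMTypeRealisation Φ B ι θ) P)
    (hA : AVDominatedBy A P) : HodgeConjectureFor A.dim A.X :=
  hodgeConjectureFor_of_avDominatedBy_isProductOf_of_weilFaceAlgebraic_on K h6 𝒮 σ₀ hgen
    (fun f hf => weilFaceAlgebraic_of_faceThetaDatum hGal f (h f hf)) hP hA

end Summit.HodgeConjecture.CorCM

end
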